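import Summits.BirchSwinnertonDyer.BirchSwinnertonDyer.Theorems.ByReductionTypeAtTwoRankOneSigmaHeightNumeratorLaw
import Summits.BirchSwinnertonDyer.BirchSwinnertonDyer.Theorems.ByReductionTypeAtTwoRankOneSigmaSqHeightData
import HarnessLib

/-!
# Route `ByReductionTypeAtTwo`, crux `RankOneAtTwoBigImageOddLocal` (item stmt-BirchSwinnertonDyer-23715), line AN62, σ₀-LEMMA BLOCK
# (cell `bsd-f1-sign2`, planner seat `-an` g50; `--supports 23715`, helper; sequel of `…SigmaHeightNumeratorLaw` / `…SigmaSqHeightData`):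
# **`num x ≡ 1 (mod 8)` on deep points, THE VALUATION LAW `‖h(P)‖₂ = ‖num x(P) − 1‖₂`, its bit laws, and THE EFFECTIVE TATE FORMULA
# `‖⟨P,P⟩ − 4⁻ᵏ·log₂ num x(2ᵏP)‖₂ ≤ 2·4ᵏ·‖x(2ᵏP)‖₂⁻²` for any height datum whose quadratic form is the naive σ-height on the locus**

HONEST FRAMING (D-0036/D-0054): THEOREMS ONLY (no definition, no named fact, no `sorry`, no instance).  Setting as in
`…SigmaHeightNumeratorLaw`: `V/ℚ` `ℤ`-integral with `a₁ = 0`, `Σ₀` its even constant-`0` sigma-squared series at `2`,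
`h(P) := log₂ den x − log₂ Σ₀(−x/y)`; nothing here is a statement about `BSDp`; item 23715 stays OPEN; BSD is proved for no curve.

* §2 `norm_cast_num_sub_one_le` / `eight_dvd_num_sub_one` — **`num x ≡ 1 (mod 8)` at `‖x‖₂ ≥ 16`**: with `a = num x`, `b = num y`,
  `d = den x` (`(den y)² = d³`), `a³ − b² = d³·(a₃y − a₂x² − a₄x − a₆)` has norm `≤ ‖x‖₂⁻¹ ≤ 1/16`, `b² ≡ 1 (mod 8)` (`b` odd), and
  `‖a³ − 1‖₂ = ‖a − 1‖₂` (`a² + a + 1` odd); `norm_padicLog_eq_of_norm_sub_one_le`: `‖log₂ a‖₂ = ‖a − 1‖₂` on `1 + 4ℤ₂`.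
* §4 at `‖x‖₂ ≥ 16` (54A of the prequel + §2): `norm_sigmaHeightTwo_le_of_sixteen_le` (**`‖h(P)‖₂ ≤ ⅛`**, the threshold of
  `norm_sigmaHeightTwo_le` lowered from `2⁸` to `2⁴`); **`norm_sigmaHeightTwo_eq_norm_num_sub_one`: `‖h(P)‖₂ = ‖num x − 1‖₂` whenever
  `‖num x − 1‖₂ > 2‖x‖₂⁻²`** (the valuation — indeed the leading digits — of the σ-height is read off the numerator of `x(P)`);
  `norm_sigmaHeightTwo_le_of_norm_num_sub_one_le` (the complement); the bit laws `norm_sigmaHeightTwo_le_sixteenth_iff`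
  (`‖h(P)‖₂ ≤ 1/16 ⟺ 16 ∣ num x − 1`) and `norm_sigmaHeightTwo_eq_eighth_iff` (`‖h(P)‖₂ = ⅛ ⟺ 16 ∤ num x − 1`).
* §5 for a HEIGHT DATUM `D : PAdicHeightData V 2` whose quadratic form is `h` on the local-conditions locus at `2` (verbatim the conclusion
  of `exists_heightData_sigmaSqZero_two`): `norm_pairing_sub_padicLog_num_le` (`‖⟨P,P⟩ − log₂ num x‖₂ ≤ 2‖x‖₂⁻²` on the locus) and
  **`norm_pairing_sub_inv_mul_padicLog_num_le` — the effective Tate formula**: for EVERY rational point `P` and every `k` with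
  `2ᵏ·P = (x', y')` in the locus, `‖⟨P,P⟩ − (4ᵏ)⁻¹·log₂ num x'‖₂ ≤ 2·4ᵏ·‖x'‖₂⁻²` (bilinearity `⟨2ᵏP,2ᵏP⟩ = 4ᵏ⟨P,P⟩`, `‖(4ᵏ)⁻¹‖₂ = 4ᵏ`).
  Since `‖x(2P)‖₂ ≥ 4‖x(P)‖₂` on the locus (tree `four_mul_padicNorm_le_padicNorm_addX`) the bound is `≤ 2·4⁻ᵏ‖x(P)‖₂⁻² → 0`:
  the pairing is the `2`-adic limit of `4⁻ᵏ·log₂ num x(2ᵏP)` — Tate's limit formula with the Iwasawa logarithm of the NUMERATOR as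
  the naive height, free of `Σ₀`.

PLACEMENT: corollary-of-print ∘ kernel (the odd-`p` shape is [Mazur–Stein–Tate 2006, §1 (1.1), Rem. 1.4, §4]; the `p`-adic Tate-limit
reading and the `mod 8 / mod 16` bit laws at `p = 2` were not found in print — MEMO-an §54 search log).  References:
[cite: MazurSteinTate2006, §1 (1.1), Rem. 1.4, §2.7, §4] [cite: Harvey2008, §5, Lemma 8] [cite: Bernardi1981, §1]
[cite: SilvermanAEC2009, VII.2.2, VIII.9] [cite: Iwasawa1972PadicL, §4.4].
-/

set_option autoImplicit false

noncomputable section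

open scoped Classical

open PowerSeries WeierstrassCurve Literature Literature.NumberTheory.EllipticCurves

namespace Summit.BirchSwinnertonDyer.BirchSwinnertonDyer.Theorems

namespace NaiveSigmaLogAtTwo

/-! ### §2 (numbering of MEMO-an §54 kept) Numerators of deep points are `≡ 1 (mod 8)` -/

/-- **`‖num x − 1‖₂ ≤ ⅛` at `‖x‖₂ ≥ 16` on a `ℤ`-integral model with `a₁ = 0`**: writing `a = num x`, `b = num y`, `d = den x`
(`(den y)² = d³`), the Weierstrass equation gives `a³ − b² = d³·(a₃y − a₂x² − a₄x − a₆)`, of norm `≤ ‖x‖₂⁻³·‖x‖₂² = ‖x‖₂⁻¹ ≤ 1/16`;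
`b` is odd, so `b² ≡ 1 (mod 8)`; and `‖a³ − 1‖ = ‖a − 1‖` because `a² + a + 1` is odd. [cite: SilvermanAEC2009, VII.2.2] -/
theorem norm_cast_num_sub_one_le (V : WeierstrassCurve ℚ) [V.IsIntegral ℤ] {x y : ℚ} (h : V.toAffine.Nonsingular x y)
    (ha1 : V.a₁ = 0) (hx : (16 : ℝ) ≤ ‖(x : ℚ_[2])‖) : ‖(x.num : ℚ_[2]) - 1‖ ≤ 8⁻¹ := by
  have hx1 : 1 < ‖(x : ℚ_[2])‖ := by linarith
  obtain ⟨hxo, hyo⟩ := odd_num_and_odd_num V h hx1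
  have hsq := WeierstrassCurve.norm_div_sq_eq_inv_norm_of_one_lt_norm h hx1
  set X : ℚ_[2] := (x : ℚ_[2]) with hXdef
  set Y : ℚ_[2] := (y : ℚ_[2]) with hYdef
  have hX0 : X ≠ 0 := fun e => by rw [e, norm_zero] at hx1; linarith
  have hY0 : Y ≠ 0 := by
    intro e
    rw [e, div_zero, norm_zero, zero_pow two_ne_zero] at hsq
    exact (inv_ne_zero (norm_ne_zero_iff.mpr hX0)) hsq.symm
  set a : ℚ_[2] := (x.num : ℚ_[2]) with hadef
  set b : ℚ_[2] := (y.num : ℚ_[2]) with hbdef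
  set dX : ℚ_[2] := (x.den : ℚ_[2]) with hdXdef
  set dY : ℚ_[2] := (y.den : ℚ_[2]) with hdYdef
  have hdX0 : dX ≠ 0 := by rw [hdXdef]; exact_mod_cast x.den_nz
  have hdY0 : dY ≠ 0 := by rw [hdYdef]; exact_mod_cast y.den_nz
  have hXnd : X = a / dX := by rw [hXdef, hadef, hdXdef]; exact_mod_cast (Rat.num_div_den x).symm
  have hYnd : Y = b / dY := by rw [hYdef, hbdef, hdYdef]; exact_mod_cast (Rat.num_div_den y).symm
  have hd32 : dX ^ 3 = dY ^ 2 := by rw [hdXdef, hdYdef]; exact_mod_cast den_pow_three_eq_den_sq V h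
  -- norms
  have hndX : ‖dX‖ = ‖X‖⁻¹ := by rw [hdXdef, norm_natCast_den_eq x, max_eq_right hx1.le]
  have hY2 : ‖Y‖ ^ 2 = ‖X‖ ^ 3 := by
    rw [norm_div, div_pow] at hsq
    field_simp at hsq
    nlinarith [hsq, norm_nonneg X, norm_nonneg Y]
  have hYle : ‖Y‖ ≤ ‖X‖ ^ 2 := by
    have h4 : ‖Y‖ ^ 2 ≤ (‖X‖ ^ 2) ^ 2 := by
      rw [hY2]; nlinarith [hx1, pow_pos (zero_lt_one.trans hx1) 3]
    exact (pow_le_pow_iff_left₀ (norm_nonneg _) (by positivity) two_ne_zero).mp h4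
  have hA2 : ‖(V.a₂ : ℚ_[2])‖ ≤ 1 := (mem_localIntegers_iff 2 _).mp (V.a₂_mem_localIntegers 2)
  have hA3 : ‖(V.a₃ : ℚ_[2])‖ ≤ 1 := (mem_localIntegers_iff 2 _).mp (V.a₃_mem_localIntegers 2)
  have hA4 : ‖(V.a₄ : ℚ_[2])‖ ≤ 1 := (mem_localIntegers_iff 2 _).mp (V.a₄_mem_localIntegers 2)
  have hA6 : ‖(V.a₆ : ℚ_[2])‖ ≤ 1 := (mem_localIntegers_iff 2 _).mp (V.a₆_mem_localIntegers 2)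
  -- the curve equation in `ℚ₂` (`a₁ = 0`)
  have heq : Y ^ 2 + (V.a₃ : ℚ_[2]) * Y = X ^ 3 + (V.a₂ : ℚ_[2]) * X ^ 2 + (V.a₄ : ℚ_[2]) * X + (V.a₆ : ℚ_[2]) := by
    have e := (WeierstrassCurve.Affine.equation_iff x y).mp h.1
    have e' := congrArg (fun q : ℚ => (q : ℚ_[2])) e
    push_cast at e'
    have e1 : ((V.toAffine.a₁ : ℚ) : ℚ_[2]) = 0 := by rw [show V.toAffine.a₁ = V.a₁ from rfl, ha1, Rat.cast_zero]
    rw [e1, zero_mul, zero_mul, add_zero] at e'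
    exact e'
  have ha : a = X * dX := by rw [hXnd, div_mul_cancel₀ _ hdX0]
  have hb2 : b ^ 2 = Y ^ 2 * dX ^ 3 := by rw [hd32, hYnd, div_pow, div_mul_cancel₀ _ (pow_ne_zero 2 hdY0)]
  have hdiff : a ^ 3 - b ^ 2 =
      dX ^ 3 * ((V.a₃ : ℚ_[2]) * Y - (V.a₂ : ℚ_[2]) * X ^ 2 - (V.a₄ : ℚ_[2]) * X - (V.a₆ : ℚ_[2])) := by
    rw [ha, hb2]; linear_combination (-(dX ^ 3)) * heq
  have hX1 : 1 ≤ ‖X‖ := hx1.le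
  have hX2 : 1 ≤ ‖X‖ ^ 2 := one_le_pow₀ hX1
  have hin : ‖(V.a₃ : ℚ_[2]) * Y - (V.a₂ : ℚ_[2]) * X ^ 2 - (V.a₄ : ℚ_[2]) * X - (V.a₆ : ℚ_[2])‖ ≤ ‖X‖ ^ 2 := by
    have n1 : ‖(V.a₃ : ℚ_[2]) * Y‖ ≤ ‖X‖ ^ 2 := by
      rw [norm_mul]; calc ‖(V.a₃ : ℚ_[2])‖ * ‖Y‖ ≤ 1 * ‖X‖ ^ 2 := by gcongr
        _ = ‖X‖ ^ 2 := one_mul _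
    have n2 : ‖(V.a₂ : ℚ_[2]) * X ^ 2‖ ≤ ‖X‖ ^ 2 := by
      rw [norm_mul, norm_pow]; calc ‖(V.a₂ : ℚ_[2])‖ * ‖X‖ ^ 2 ≤ 1 * ‖X‖ ^ 2 := by gcongr
        _ = ‖X‖ ^ 2 := one_mul _
    have hXX : ‖X‖ ≤ ‖X‖ ^ 2 := by nlinarith [hX1]
    have n3 : ‖(V.a₄ : ℚ_[2]) * X‖ ≤ ‖X‖ ^ 2 := by
      rw [norm_mul]
      calc ‖(V.a₄ : ℚ_[2])‖ * ‖X‖ ≤ 1 * ‖X‖ ^ 2 := mul_le_mul hA4 hXX (norm_nonneg _) zero_le_one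
        _ = ‖X‖ ^ 2 := one_mul _
    have n4 : ‖(V.a₆ : ℚ_[2])‖ ≤ ‖X‖ ^ 2 := hA6.trans hX2
    rw [show (V.a₃ : ℚ_[2]) * Y - (V.a₂ : ℚ_[2]) * X ^ 2 - (V.a₄ : ℚ_[2]) * X - (V.a₆ : ℚ_[2]) =
        (V.a₃ : ℚ_[2]) * Y + -((V.a₂ : ℚ_[2]) * X ^ 2) + -((V.a₄ : ℚ_[2]) * X) + -(V.a₆ : ℚ_[2]) by ring]
    refine (IsUltrametricDist.norm_add_le_max _ _).trans (max_le ?_ (by rw [norm_neg]; exact n4))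
    refine (IsUltrametricDist.norm_add_le_max _ _).trans (max_le ?_ (by rw [norm_neg]; exact n3))
    exact (IsUltrametricDist.norm_add_le_max _ _).trans (max_le n1 (by rw [norm_neg]; exact n2))
  have h1 : ‖a ^ 3 - b ^ 2‖ ≤ 16⁻¹ := by
    rw [hdiff, norm_mul, norm_pow, hndX]
    calc ‖X‖⁻¹ ^ 3 * ‖(V.a₃ : ℚ_[2]) * Y - (V.a₂ : ℚ_[2]) * X ^ 2 - (V.a₄ : ℚ_[2]) * X - (V.a₆ : ℚ_[2])‖
        ≤ ‖X‖⁻¹ ^ 3 * ‖X‖ ^ 2 := by gcongr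
      _ = ‖X‖⁻¹ := by field_simp
      _ ≤ 16⁻¹ := by exact inv_anti₀ (by norm_num) hx
  -- `b² ≡ 1 (mod 8)`
  have h2' : ‖b ^ 2 - 1‖ ≤ 8⁻¹ := by
    have h8 := (Padic.norm_int_le_pow_iff_dvd (p := 2) (y.num ^ 2 - 1 ^ 2) 3).mpr
      (by have e := eight_dvd_sq_sub_sq_of_odd hyo odd_one; norm_num at e ⊢; exact e)
    have e : ((y.num ^ 2 - 1 ^ 2 : ℤ) : ℚ_[2]) = b ^ 2 - 1 := by rw [hbdef]; push_cast; ring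
    rw [e] at h8
    exact h8.trans (by norm_num)
  have h3 : ‖a ^ 3 - 1‖ ≤ 8⁻¹ := by
    rw [show a ^ 3 - 1 = (a ^ 3 - b ^ 2) + (b ^ 2 - 1) by ring]
    exact (IsUltrametricDist.norm_add_le_max _ _).trans (max_le (h1.trans (by norm_num)) h2')
  -- `‖a² + a + 1‖ = 1`
  have hodd : Odd (x.num ^ 2 + x.num + 1) := by
    obtain ⟨k, hk⟩ := hxo
    exact ⟨2 * k ^ 2 + 3 * k + 1, by rw [hk]; ring⟩
  have hunit : ‖a ^ 2 + a + 1‖ = 1 := by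
    have := DepletionAtTwo.norm_intCast_eq_one_of_odd hodd
    rw [hadef]; push_cast at this; exact this
  have hfac : a ^ 3 - 1 = (a - 1) * (a ^ 2 + a + 1) := by ring
  rw [hfac, norm_mul, hunit, mul_one] at h3
  exact h3

/-- Integer form: **`8 ∣ num x − 1`** for a point with `‖x‖₂ ≥ 16` on a `ℤ`-integral model with `a₁ = 0`. -/
theorem eight_dvd_num_sub_one (V : WeierstrassCurve ℚ) [V.IsIntegral ℤ] {x y : ℚ} (h : V.toAffine.Nonsingular x y)
    (ha1 : V.a₁ = 0) (hx : (16 : ℝ) ≤ ‖(x : ℚ_[2])‖) : (8 : ℤ) ∣ x.num - 1 := by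
  have hle := norm_cast_num_sub_one_le V h ha1 hx
  have h8 := (Padic.norm_int_le_pow_iff_dvd (p := 2) (x.num - 1) 3).mp (by push_cast; exact hle.trans (by norm_num))
  norm_num at h8
  exact h8

/-- `‖log₂ a‖₂ = ‖a − 1‖₂` for `‖a − 1‖₂ ≤ ¼` (the logarithm is an isometry on `1 + 4ℤ₂`). [cite: Iwasawa1972PadicL, §4.4] -/
theorem norm_padicLog_eq_of_norm_sub_one_le {a : ℚ_[2]} (ha : ‖a - 1‖ ≤ 4⁻¹) : ‖padicLog 2 a‖ = ‖a - 1‖ := by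
  have h1 : ‖1 - a‖ = ‖a - 1‖ := by rw [← norm_neg, neg_sub]
  have hlt1 : ‖1 - a‖ < 1 := by rw [h1]; linarith
  have hlt2 : ‖1 - a‖ < ‖(2 : ℚ_[2])‖ := by rw [h1, Rank2Observatory.padic_norm_two]; linarith
  rw [padicLog_eq_padicLogSeries hlt1, norm_padicLogSeries_eq hlt2, h1]

/-! ### §4 Corollaries at `‖x‖₂ ≥ 16`: the valuation law and the low bits -/

/-- `2‖x‖₂⁻² ≤ 1/128` at `‖x‖₂ ≥ 16`. -/
theorem two_mul_inv_norm_sq_le {x : ℚ} (hx : (16 : ℝ) ≤ ‖(x : ℚ_[2])‖) : 2 * ‖(x : ℚ_[2])‖⁻¹ ^ 2 ≤ 128⁻¹ := by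
  have hi : ‖(x : ℚ_[2])‖⁻¹ ≤ 16⁻¹ := inv_anti₀ (by norm_num) hx
  have hi0 : 0 ≤ ‖(x : ℚ_[2])‖⁻¹ := by positivity
  nlinarith [hi, hi0]

section Corollaries

variable (V : WeierstrassCurve ℚ) [V.IsIntegral ℤ] {x y : ℚ} (h : V.toAffine.Nonsingular x y)
  (ha1 : V.a₁ = 0) (Sq : ℚ_[2]⟦X⟧) (h0 : constantCoeff Sq = 0) (h1 : coeff 1 Sq = 0) (h2 : coeff 2 Sq = 1) (h3 : coeff 3 Sq = 0)
  (hODE : (V.baseChange ℚ_[2]).SatisfiesSigmaSqODE Sq 0) (hx : (16 : ℝ) ≤ ‖(x : ℚ_[2])‖)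
include h ha1 h0 h1 h2 h3 hODE hx

/-- **`‖h(P)‖₂ ≤ ⅛` already at `‖x‖₂ ≥ 16`** (54A + `num x ≡ 1 (mod 8)` + the isometry of `log₂` on `1 + 4ℤ₂`). -/
theorem norm_sigmaHeightTwo_le_of_sixteen_le :
    ‖padicLog 2 (x.den : ℚ_[2]) - padicLog 2 (padicEval Sq (-(x : ℚ_[2]) / y))‖ ≤ 8⁻¹ := by
  have hA := norm_sigmaHeightTwo_sub_padicLog_num_le V h ha1 Sq h0 h1 h2 h3 hODE hx
  have hsmall := two_mul_inv_norm_sq_le hx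
  have hn := norm_cast_num_sub_one_le V h ha1 hx
  have hlog : ‖padicLog 2 (x.num : ℚ_[2])‖ ≤ 8⁻¹ := by
    rw [norm_padicLog_eq_of_norm_sub_one_le (hn.trans (by norm_num))]; exact hn
  set H := padicLog 2 (x.den : ℚ_[2]) - padicLog 2 (padicEval Sq (-(x : ℚ_[2]) / y))
  rw [show H = (H - padicLog 2 (x.num : ℚ_[2])) + padicLog 2 (x.num : ℚ_[2]) by ring]
  exact (IsUltrametricDist.norm_add_le_max _ _).trans (max_le (hA.trans (hsmall.trans (by norm_num))) hlog)

/-- **THE VALUATION LAW (kernel): `‖h(P)‖₂ = ‖num x − 1‖₂` whenever `‖num x − 1‖₂ > 2‖x‖₂⁻²`** — the `2`-adic valuation (indeed the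
leading digits) of the naive σ-height of a deep point is read off the numerator of `x(P)`. -/
theorem norm_sigmaHeightTwo_eq_norm_num_sub_one (hbig : 2 * ‖(x : ℚ_[2])‖⁻¹ ^ 2 < ‖(x.num : ℚ_[2]) - 1‖) :
    ‖padicLog 2 (x.den : ℚ_[2]) - padicLog 2 (padicEval Sq (-(x : ℚ_[2]) / y))‖ = ‖(x.num : ℚ_[2]) - 1‖ := by
  have hA := norm_sigmaHeightTwo_sub_padicLog_num_le V h ha1 Sq h0 h1 h2 h3 hODE hx
  have hn := norm_cast_num_sub_one_le V h ha1 hx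
  have hlog : ‖padicLog 2 (x.num : ℚ_[2])‖ = ‖(x.num : ℚ_[2]) - 1‖ :=
    norm_padicLog_eq_of_norm_sub_one_le (hn.trans (by norm_num))
  set H := padicLog 2 (x.den : ℚ_[2]) - padicLog 2 (padicEval Sq (-(x : ℚ_[2]) / y))
  have hne : ‖H - padicLog 2 (x.num : ℚ_[2])‖ ≠ ‖padicLog 2 (x.num : ℚ_[2])‖ := by
    rw [hlog]; exact ne_of_lt (lt_of_le_of_lt hA hbig)
  rw [show H = (H - padicLog 2 (x.num : ℚ_[2])) + padicLog 2 (x.num : ℚ_[2]) by ring, Padic.add_eq_max_of_ne hne, hlog]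
  exact max_eq_right ((hA.trans hbig.le))

/-- Complement: **`‖h(P)‖₂ ≤ 2‖x‖₂⁻²` whenever `‖num x − 1‖₂ ≤ 2‖x‖₂⁻²`**. -/
theorem norm_sigmaHeightTwo_le_of_norm_num_sub_one_le (hsmall : ‖(x.num : ℚ_[2]) - 1‖ ≤ 2 * ‖(x : ℚ_[2])‖⁻¹ ^ 2) :
    ‖padicLog 2 (x.den : ℚ_[2]) - padicLog 2 (padicEval Sq (-(x : ℚ_[2]) / y))‖ ≤ 2 * ‖(x : ℚ_[2])‖⁻¹ ^ 2 := by
  have hA := norm_sigmaHeightTwo_sub_padicLog_num_le V h ha1 Sq h0 h1 h2 h3 hODE hx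
  have hn := norm_cast_num_sub_one_le V h ha1 hx
  have hlog : ‖padicLog 2 (x.num : ℚ_[2])‖ = ‖(x.num : ℚ_[2]) - 1‖ :=
    norm_padicLog_eq_of_norm_sub_one_le (hn.trans (by norm_num))
  set H := padicLog 2 (x.den : ℚ_[2]) - padicLog 2 (padicEval Sq (-(x : ℚ_[2]) / y))
  rw [show H = (H - padicLog 2 (x.num : ℚ_[2])) + padicLog 2 (x.num : ℚ_[2]) by ring]
  exact (IsUltrametricDist.norm_add_le_max _ _).trans (max_le hA (by rw [hlog]; exact hsmall))

/-- **Bit law: `‖h(P)‖₂ ≤ 1/16 ⟺ 16 ∣ num x − 1`** at `‖x‖₂ ≥ 16`. -/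
theorem norm_sigmaHeightTwo_le_sixteenth_iff :
    ‖padicLog 2 (x.den : ℚ_[2]) - padicLog 2 (padicEval Sq (-(x : ℚ_[2]) / y))‖ ≤ 16⁻¹ ↔ (16 : ℤ) ∣ x.num - 1 := by
  have hA := norm_sigmaHeightTwo_sub_padicLog_num_le V h ha1 Sq h0 h1 h2 h3 hODE hx
  have h128 := two_mul_inv_norm_sq_le hx
  have hn := norm_cast_num_sub_one_le V h ha1 hx
  have hlog : ‖padicLog 2 (x.num : ℚ_[2])‖ = ‖(x.num : ℚ_[2]) - 1‖ :=
    norm_padicLog_eq_of_norm_sub_one_le (hn.trans (by norm_num))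
  have hdvd : (16 : ℤ) ∣ x.num - 1 ↔ ‖(x.num : ℚ_[2]) - 1‖ ≤ 16⁻¹ := by
    have e := Padic.norm_int_le_pow_iff_dvd (p := 2) (x.num - 1) 4
    norm_num at e
    rw [one_div] at e
    exact e.symm
  rw [hdvd]
  set H := padicLog 2 (x.den : ℚ_[2]) - padicLog 2 (padicEval Sq (-(x : ℚ_[2]) / y))
  have hsmall : ‖H - padicLog 2 (x.num : ℚ_[2])‖ ≤ 16⁻¹ := hA.trans (h128.trans (by norm_num))
  constructor
  · intro hH
    rw [← hlog, show padicLog 2 (x.num : ℚ_[2]) = -(H - padicLog 2 (x.num : ℚ_[2])) + H by ring]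
    exact (IsUltrametricDist.norm_add_le_max _ _).trans (max_le (by rw [norm_neg]; exact hsmall) hH)
  · intro hN
    rw [show H = (H - padicLog 2 (x.num : ℚ_[2])) + padicLog 2 (x.num : ℚ_[2]) by ring]
    exact (IsUltrametricDist.norm_add_le_max _ _).trans (max_le hsmall (by rw [hlog]; exact hN))

/-- **Bit law: `‖h(P)‖₂ = ⅛ ⟺ 16 ∤ num x − 1`** at `‖x‖₂ ≥ 16` (norms in `ℚ₂` are powers of `2`). -/
theorem norm_sigmaHeightTwo_eq_eighth_iff :
    ‖padicLog 2 (x.den : ℚ_[2]) - padicLog 2 (padicEval Sq (-(x : ℚ_[2]) / y))‖ = 8⁻¹ ↔ ¬ (16 : ℤ) ∣ x.num - 1 := by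
  rw [← norm_sigmaHeightTwo_le_sixteenth_iff V h ha1 Sq h0 h1 h2 h3 hODE hx, not_le]
  have hle := norm_sigmaHeightTwo_le_of_sixteen_le V h ha1 Sq h0 h1 h2 h3 hODE hx
  set H := padicLog 2 (x.den : ℚ_[2]) - padicLog 2 (padicEval Sq (-(x : ℚ_[2]) / y))
  refine ⟨fun e => lt_of_lt_of_eq (by norm_num) e.symm, fun hgt => le_antisymm hle ?_⟩
  have hne : H ≠ 0 := fun e => by rw [e, norm_zero] at hgt; norm_num at hgt
  rw [Padic.norm_eq_zpow_neg_valuation hne] at hgt ⊢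
  have h4 : -(4 : ℤ) < -H.valuation := by
    by_contra hle'
    rw [not_lt] at hle'
    have := zpow_le_zpow_right₀ (by norm_num : (1 : ℝ) ≤ 2) hle'
    exact absurd (lt_of_lt_of_le hgt this) (by norm_num)
  calc (8⁻¹ : ℝ) = (2 : ℝ) ^ (-(3 : ℤ)) := by norm_num
    _ ≤ _ := zpow_le_zpow_right₀ (by norm_num : (1 : ℝ) ≤ 2) (by omega)

end Corollaries

/-! ### §5 Height data: the numerator law for `⟨P,P⟩` and the effective Tate formula -/

/-- **The numerator law for a height DATUM**: if `D : PAdicHeightData V 2` has quadratic form `log₂ den x − log₂ Σ₀(−x/y)` on the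
local-conditions locus at `2` (the conclusion of `exists_heightData_sigmaSqZero_two`), then for every `P = (x, y)` in the locus
`‖⟨P,P⟩_D − log₂ num x‖₂ ≤ 2‖x‖₂⁻²`. [cite: MazurSteinTate2006, §1 (1.1), Rem. 1.4] -/
theorem norm_pairing_sub_padicLog_num_le (V : WeierstrassCurve ℚ) [V.IsIntegral ℤ] (ha1 : V.a₁ = 0) (Sq : ℚ_[2]⟦X⟧)
    (h0 : constantCoeff Sq = 0) (h1 : coeff 1 Sq = 0) (h2 : coeff 2 Sq = 1) (h3 : coeff 3 Sq = 0)
    (hODE : (V.baseChange ℚ_[2]).SatisfiesSigmaSqODE Sq 0) (D : PAdicHeightData V 2)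
    (hD : ∀ {x y : ℚ} (h : V.toAffine.Nonsingular x y), V.SatisfiesLocalConditions 2 (.some x y h) →
      D.pairing (.some x y h) (.some x y h) = padicLog 2 ((x.den : ℚ) : ℚ_[2]) - padicLog 2 (padicEval Sq (-(x : ℚ_[2]) / y)))
    {x y : ℚ} (h : V.toAffine.Nonsingular x y) (hP : V.SatisfiesLocalConditions 2 (.some x y h)) :
    ‖D.pairing (.some x y h) (.some x y h) - padicLog 2 (x.num : ℚ_[2])‖ ≤ 2 * ‖(x : ℚ_[2])‖⁻¹ ^ 2 := by
  have hx1 := hP.1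
  have hdisc := hP.2.1
  have hx16 : (16 : ℝ) ≤ ‖(x : ℚ_[2])‖ := by
    -- `‖−x/y‖ < ½ ⟹ ‖−x/y‖ ≤ ¼ ⟹ ‖x‖ = ‖−x/y‖⁻² ≥ 16`
    have hz := norm_lt_half_of_inSigmaDisc_two hdisc
    have hsq := WeierstrassCurve.norm_div_sq_eq_inv_norm_of_one_lt_norm h hx1
    rw [← norm_neg, ← neg_div] at hsq
    have hX0 : (x : ℚ_[2]) ≠ 0 := fun e => by rw [e, norm_zero] at hx1; linarith
    set z : ℚ_[2] := -(x : ℚ_[2]) / y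
    have hz0 : z ≠ 0 := fun e => by
      rw [e, norm_zero, zero_pow two_ne_zero] at hsq; exact (inv_ne_zero (norm_ne_zero_iff.mpr hX0)) hsq.symm
    -- norms are powers of two: `‖z‖ < ½ ⟹ ‖z‖ ≤ ¼`
    have hz4 : ‖z‖ ≤ 4⁻¹ := by
      rw [Padic.norm_eq_zpow_neg_valuation hz0] at hz ⊢
      have hv : -z.valuation ≤ -(2 : ℤ) := by
        by_contra hgt
        rw [not_le] at hgt
        have := zpow_le_zpow_right₀ (by norm_num : (1 : ℝ) ≤ 2) (show -(1 : ℤ) ≤ -z.valuation by omega)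
        exact absurd (lt_of_le_of_lt this hz) (by norm_num)
      exact (zpow_le_zpow_right₀ (by norm_num : (1 : ℝ) ≤ 2) hv).trans (by norm_num)
    have hx' : ‖(x : ℚ_[2])‖ = (‖z‖ ^ 2)⁻¹ := by rw [hsq, inv_inv]
    rw [hx']
    have hzsq : ‖z‖ ^ 2 ≤ 16⁻¹ := by nlinarith [hz4, norm_nonneg z]
    have hzpos : 0 < ‖z‖ ^ 2 := by positivity
    calc (16 : ℝ) = (16⁻¹)⁻¹ := by norm_num
      _ ≤ (‖z‖ ^ 2)⁻¹ := inv_anti₀ hzpos hzsq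
  rw [hD h hP]
  push_cast
  exact norm_sigmaHeightTwo_sub_padicLog_num_le V h ha1 Sq h0 h1 h2 h3 hODE hx16

/-- **THE EFFECTIVE TATE FORMULA (kernel)**: with `D` as above, for EVERY rational point `P` and every `k` such that `2ᵏ·P = (x', y')`
lies in the local-conditions locus at `2`, `‖⟨P,P⟩_D − (4ᵏ)⁻¹·log₂ num x'‖₂ ≤ 2·4ᵏ·‖x'‖₂⁻²` (bilinearity: `⟨2ᵏP, 2ᵏP⟩ = 4ᵏ⟨P,P⟩`, and
`‖(4ᵏ)⁻¹‖₂ = 4ᵏ`).  Since `‖x(2ᵏP)‖₂ ≥ 4ᵏ‖x(P)‖₂` on the locus, the bound is `≤ 2·4⁻ᵏ‖x(P)‖₂⁻² → 0`: the σ-height pairing is the `2`-adic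
limit of `4⁻ᵏ·log₂ num x(2ᵏP)` — Tate's limit with the Iwasawa logarithm of the numerator in place of the naive height.
[cite: SilvermanAEC2009, VIII.9] [cite: MazurSteinTate2006, §1] -/
theorem norm_pairing_sub_inv_mul_padicLog_num_le (V : WeierstrassCurve ℚ) [V.IsIntegral ℤ] (ha1 : V.a₁ = 0) (Sq : ℚ_[2]⟦X⟧)
    (h0 : constantCoeff Sq = 0) (h1 : coeff 1 Sq = 0) (h2 : coeff 2 Sq = 1) (h3 : coeff 3 Sq = 0)
    (hODE : (V.baseChange ℚ_[2]).SatisfiesSigmaSqODE Sq 0) (D : PAdicHeightData V 2)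
    (hD : ∀ {x y : ℚ} (h : V.toAffine.Nonsingular x y), V.SatisfiesLocalConditions 2 (.some x y h) →
      D.pairing (.some x y h) (.some x y h) = padicLog 2 ((x.den : ℚ) : ℚ_[2]) - padicLog 2 (padicEval Sq (-(x : ℚ_[2]) / y)))
    (P : V.toAffine.Point) (k : ℕ) {x' y' : ℚ} (h' : V.toAffine.Nonsingular x' y') (hk : (2 ^ k : ℕ) • P = .some x' y' h')
    (hQ : V.SatisfiesLocalConditions 2 (.some x' y' h')) :
    ‖D.pairing P P - ((4 : ℚ_[2]) ^ k)⁻¹ * padicLog 2 (x'.num : ℚ_[2])‖ ≤ 2 * 4 ^ k * ‖(x' : ℚ_[2])‖⁻¹ ^ 2 := by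
  have hQQ := norm_pairing_sub_padicLog_num_le V ha1 Sq h0 h1 h2 h3 hODE D hD h' hQ
  have h4k : ((2 ^ k * 2 ^ k : ℕ) : ℚ_[2]) = (4 : ℚ_[2]) ^ k := by
    push_cast; rw [← mul_pow]; norm_num
  have hscale : D.pairing (.some x' y' h') (.some x' y' h') = (4 : ℚ_[2]) ^ k * D.pairing P P := by
    rw [← hk, map_nsmul, map_nsmul, AddMonoidHom.nsmul_apply, smul_smul, nsmul_eq_mul, h4k]
  have h4 : ((4 : ℚ_[2]) ^ k) ≠ 0 := pow_ne_zero k (by norm_num)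
  have hn4 : ‖((4 : ℚ_[2]) ^ k)⁻¹‖ = 4 ^ k := by
    rw [norm_inv, norm_pow, ← inv_pow]
    congr 1
    rw [show (4 : ℚ_[2]) = 2 * 2 by norm_num, norm_mul, Rank2Observatory.padic_norm_two]; norm_num
  have e : D.pairing P P - ((4 : ℚ_[2]) ^ k)⁻¹ * padicLog 2 (x'.num : ℚ_[2]) =
      ((4 : ℚ_[2]) ^ k)⁻¹ * (D.pairing (.some x' y' h') (.some x' y' h') - padicLog 2 (x'.num : ℚ_[2])) := by
    rw [hscale]; field_simp
  rw [e, norm_mul, hn4]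
  calc (4 : ℝ) ^ k * ‖D.pairing (.some x' y' h') (.some x' y' h') - padicLog 2 (x'.num : ℚ_[2])‖
      ≤ 4 ^ k * (2 * ‖(x' : ℚ_[2])‖⁻¹ ^ 2) := by gcongr
    _ = 2 * 4 ^ k * ‖(x' : ℚ_[2])‖⁻¹ ^ 2 := by ring

end NaiveSigmaLogAtTwo

end Summit.BirchSwinnertonDyer.BirchSwinnertonDyer.Theorems
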